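/-
Copyright: cell `pub-ymgap` (HUMAN RULING D-0062), Track A of `YM-PLAN.md`, DAG node N20 (= NE7b); R134 seat `pub-ymgap-dag-n20-d`
(strategy s3 «alternative currency», generation 5), module 4.  Released under the licence of the surrounding project.
-/
import Summits.QuantumFields.YangMills.Theorems.BalabanUVNodesN20ByValueTelescoping
import Summits.QuantumFields.BalabanUV.T4Continuum.Spine.NE7b.StepKernelOps
import Summits.QuantumFields.BalabanUV.T4Continuum.Spine.NE7b.StepKernelOfMap

/-!
# YM-DAG node N20 (= NE7b), strategy s3, THE FOURTH CURRENCY «BY VALUE» (module 4): FIBRE-SUPPORTED KERNEL STEPS ARE MODULE STEPS — a one-step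
# operation given by a finite transition kernel (gaps-ne6's `StepKernelOps.ofKernel κ`) whose fibres `κ y` live on `{x | avg x = y}` and whose ONE
# measure identity `κ ∘ₘ ν' = χ·ν` holds has module 1's MODULE PROPERTY; gaps-ne6's averaging kernels (`condLaw` twisted by a density:
# `StepKernelOfMap.mapStepKernel` ∕ `truncStepKernel`) ARE fibre-supported almost everywhere

Track A of `YM-PLAN.md` (cell `pub-ymgap`, HUMAN RULING D-0062), node **N20** = spine estimate NE7b (`T4WeightBudget.RelWeightBound` — the cell
`pub-balaban`'s OWN estimate, NOT PRINTED in [Bałaban 1983–89], NOT PROVED).  Seat `pub-ymgap-dag-n20-d` (R134, s3), generation 5, module 4 after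
`…N20ByValueTelescoping` (p496513), `…N20ByValueExtraction` (p497227), `…N20ByValueAtRecord` (module 3).  Kernel theorems only: 0 `def`, 0 `sorry`,
standard axioms; COUNT-NEUTRAL (`--supports` K3‴ `SpineGivenEndpointR13`, stmt-QuantumFields-19912, `--as helper`).  Restate-immune (no Theses import).

THE POINT.  gaps-ne6's (A1c)-facing files give the END's per-(step, choice) integral identity `hstep` for a tower whose operations ARE kernel steps
(`StepKernelOps.ofKernel κ`, `(ofKernel κ).T f y = ∫ f d(κ y)`) from ONE measure identity per (step, choice), `κ ∘ₘ ν' = χ·ν`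
(`StepKernelOps.hstep_of_comp_eq` ∕ `hstep_of_kernels`).  Module 1's MODULE PROPERTY `hmod` is `hstep` with an extra bounded-measurable weight `m` of the
NEW level pulled back along a level map `avg`; what it needs beyond the measure identity is exactly that the fibres of `κ` live on the fibres of `avg`:
  (FS) `∀ᵐ y ∂ν', ∀ᵐ x ∂(κ y), avg x = y`
— «the kernel form of the constraint `δ(ŪV⁻¹)`» (`T4AveragingDisintegration.condLaw_fibre_ae`).  So:
* §1 `integral_mul_ofKernel_of_fibre`: ONE kernel — measure identity + (FS) ⟹ `∫ m·(ofKernel κ).T f dν' = ∫ (m ∘ avg)·(χ·f) dν` for bounded-measurable `m`,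
  `f` (push `m y` under the fibre integral, replace it by `m (avg x)` on the fibre, apply `hstep_of_comp_eq` to the good function `(m ∘ avg)·f`);
  ★ `hmod_of_kernels`: the tower form in the END's binder shape (twin of `StepKernelOps.hstep_of_kernels`): operations that ARE kernel steps (`hop`), one
  measure identity (`hκ`) and (FS) (`hfib`) per admissible (step, choice) ⟹ module 1's `hmod`.
* §2 (FS) FOR gaps-ne6's AVERAGING KERNELS: `ae_fibre_twist` (twisting by a density of the target level preserves (FS) fibrewise); `ae_fibre_condLaw` (the
  conditional kernel of a measurable map lives on its fibres `(ν.map avg)`-a.e. — `condLaw_fibre_ae` in a.e. form); ★ `ae_fibre_mapStepKernel` and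
  `ae_fibre_truncStepKernel`: the averaging step kernel `condLaw` twisted by the marginal density `d(avg_*ν)∕dμ` (resp. its truncation) satisfies (FS)
  `μ`-ALMOST EVERYWHERE under `ν.map avg ≪ μ` — off the support of the marginal density the twisted fibre is the zero measure, on it `μ`-a.e. is
  `(ν.map avg)`-a.e. (`withDensity_margDensity` + `ae_withDensity_iff`); `ae_fibre_avgKernel_twist` (gauge fields, `HaarAC`); `ae_fibre_fibredStepKernel`
  (the substrate cell's Markov fibred route `fibredStepKernel A`: (FS) at EVERY coarse field, from `avg ∘ Φ(·, V) = V`).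
NET for an (A1c) instance built per gaps-ne6's recipe (`op := ofKernel (𝐑-term ∘ₖ averaging kernel)`): the 𝐓-half is fibre-supported by §2; whether the
𝐑∘χ-half keeps the composite on the fibres of `avg` (it resamples OLDER variables at FIXED new field — [Balaban1989LargeFieldI] (0.3) p. 176, LOCATOR) is the
(A1c) check module 1 displays as `hmod`; given it, modules 1–2 turn the END's per-class display into ONE joint-sparseness inequality under the level-0 state.

HONEST FRAMING.  Count-neutral kernel bookkeeping [folklore] (Mathlib kernels: `Kernel.withDensity`, `Measure.bind`, `ae_withDensity_iff`; gaps-ne6's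
`ofKernel`∕`twist`∕`mapStepKernel` BY NAME); no kernel of Bałaban's is named; no tower constructed; nothing of Bałaban's asserted, valued or instantiated;
NE7b NOT PRINTED ∕ NOT PROVED; the (α)-instance 0∕1; N20 NOT discharged (typed 28∕28, discharged count untouched); one finite four-torus programme at fixed
`ε` — NOT ℝ⁴, NOT infinite volume, NOT OS, NOT a mass gap, NOT Clay.  References (LOCATORS only; no decl carries a cite tag): T. Bałaban, CMP **98** (1985)
17–51 [Balaban1985Averaging] ((10) p. 19); CMP **122** (1989) 175–202 [Balaban1989LargeFieldI] ((0.3)–(0.4) p. 176).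
-/

set_option autoImplicit false

noncomputable section

open MeasureTheory ProbabilityTheory
open scoped ENNReal
open Summit.QuantumFields.BalabanUV.T4Continuum.B16HistoryIndexedRepr
open Summit.QuantumFields.BalabanUV.T4Continuum.B16HistoryReprChain
open Summit.QuantumFields.BalabanUV.T4Continuum.Spine.NE7b.StepKernelOps (ofKernel ofKernel_apply hstep_of_comp_eq)
open Summit.QuantumFields.BalabanUV.T4Continuum.Spine.NE7b.StepKernelOfMap (twist twist_apply mapStepKernel truncStepKernel
  measurable_margDensity_ennreal measurable_truncDensity)
open Literature.MathematicalPhysics.QuantumFieldTheory.Balaban1983to89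
open Literature.MathematicalPhysics.QuantumFieldTheory.Balaban1983to89.T4AveragingDisintegration (condLaw condLaw_fibre_ae margDensity
  withDensity_margDensity avgKernel)

namespace Summit.QuantumFields.YangMills.BalabanUVNodes.N20ByValueKernelSteps

/-! ## §1 A fibre-supported kernel step with its measure identity is a module step -/

section OneKernel

variable {X Y : Type} [MeasurableSpace X] [MeasurableSpace Y] (κ : Kernel Y X) [IsFiniteKernel κ]

/-- A bounded-measurable function of the new level pulled back along a measurable level map is bounded-measurable. [folklore] -/
theorem bddMeas_comp {avg : X → Y} (havg : Measurable avg) {m : Y → ℝ} (hm : (bddMeas Y).Gd m) : (bddMeas X).Gd fun x => m (avg x) := by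
  obtain ⟨hmm, B, hB⟩ := hm
  exact ⟨hmm.comp havg, B, fun x => hB (avg x)⟩

/-- **ONE FIBRE-SUPPORTED KERNEL STEP IS A MODULE STEP.**  For a finite kernel `κ` from the new level `Y` to the old level `X` with the measure identity
`κ ∘ₘ ν' = χ·ν` (`χ ≥ 0` measurable) whose fibres live on the fibres of a measurable level map `avg : X → Y` for `ν'`-a.e. `y` (FS), and bounded-measurable
`m`, `f`:  `∫ m·(ofKernel κ).T f dν' = ∫ (m ∘ avg)·(χ·f) dν`.  (`hstep_of_comp_eq` is the case `m = 1`.) [folklore] -/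
theorem integral_mul_ofKernel_of_fibre (ν : Measure X) (ν' : Measure Y) [IsFiniteMeasure ν'] {avg : X → Y} (havg : Measurable avg)
    {χ : X → ℝ} (hχm : Measurable χ) (hχ0 : ∀ x, 0 ≤ χ x) (hκ : κ ∘ₘ ν' = ν.withDensity fun x => ENNReal.ofReal (χ x))
    (hfib : ∀ᵐ y ∂ν', ∀ᵐ x ∂(κ y), avg x = y) {m : Y → ℝ} (hm : (bddMeas Y).Gd m) {f : X → ℝ} (hf : (bddMeas X).Gd f) :
    ∫ y, m y * (ofKernel κ).T f y ∂ν' = ∫ x, m (avg x) * (χ x * f x) ∂ν := by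
  have hmf : (bddMeas X).Gd fun x => m (avg x) * f x := (bddMeas X).mul (bddMeas_comp havg hm) hf
  have h1 : (fun y => m y * (ofKernel κ).T f y) =ᵐ[ν'] fun y => (ofKernel κ).T (fun x => m (avg x) * f x) y := by
    filter_upwards [hfib] with y hy
    rw [ofKernel_apply, ofKernel_apply, ← integral_const_mul]
    refine integral_congr_ae ?_
    filter_upwards [hy] with x hx
    rw [hx]
  rw [integral_congr_ae h1, hstep_of_comp_eq κ ν ν' hχm hχ0 hκ hmf]
  refine integral_congr_ae (Filter.Eventually.of_forall fun x => ?_)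
  show χ x * (m (avg x) * f x) = m (avg x) * (χ x * f x)
  ring

end OneKernel

section TowerForm

variable {P : Type} {X' : ℕ → Type} [∀ j, MeasurableSpace (X' j)] (T : Tower P X' fun j => bddMeas (X' j))
  (κs : (j : ℕ) → (Fin j → P) → P → Kernel (X' (j + 1)) (X' j)) [∀ j g p, IsFiniteKernel (κs j g p)]
  (ν : (j : ℕ) → Measure (X' j)) [∀ j, IsFiniteMeasure (ν j)]
  (avg : (j : ℕ) → X' j → X' (j + 1)) (χ : (j : ℕ) → (Fin j → P) → P → X' j → ℝ)

/-- **THE MODULE PROPERTY IN THE END's BINDER SHAPE FOR A TOWER OF KERNEL STEPS** (twin of gaps-ne6's `StepKernelOps.hstep_of_kernels`): operations that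
ARE kernel steps (`hop`), measurable non-negative characteristic functions, ONE measure identity (`hκ`) and the fibre support (FS) (`hfib`) per admissible
(step, choice) ⟹ module 1's `hmod` with `μ := ν`, level maps `avg`. [folklore] -/
theorem hmod_of_kernels (hop : ∀ (j : ℕ) (g : Fin j → P) (p : P) (f : X' j → ℝ) (y : X' (j + 1)), (T.op j g p).T f y = ∫ x, f x ∂κs j g p y)
    (havg : ∀ j, Measurable (avg j)) (hχm : ∀ j g p, Measurable (χ j g p)) (hχ0 : ∀ j g p x, 0 ≤ χ j g p x)
    (hκ : ∀ (j : ℕ) (g : Fin j → P) (p : P), g ∈ T.adm j → p ∈ T.branch j g →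
      κs j g p ∘ₘ ν (j + 1) = (ν j).withDensity fun x => ENNReal.ofReal (χ j g p x))
    (hfib : ∀ (j : ℕ) (g : Fin j → P) (p : P), g ∈ T.adm j → p ∈ T.branch j g → ∀ᵐ y ∂ν (j + 1), ∀ᵐ x ∂(κs j g p y), avg j x = y) :
    ∀ (j : ℕ) (g : Fin j → P) (p : P), g ∈ T.adm j → p ∈ T.branch j g → ∀ (m : X' (j + 1) → ℝ) (f : X' j → ℝ),
      (bddMeas (X' (j + 1))).Gd m → (bddMeas (X' j)).Gd f →
        ∫ y, m y * (T.op j g p).T f y ∂ν (j + 1) = ∫ x, m (avg j x) * (χ j g p x * f x) ∂ν j := by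
  intro j g p hg hp m f hm hf
  have e : (fun y => m y * (T.op j g p).T f y) = fun y => m y * (ofKernel (κs j g p)).T f y :=
    funext fun y => by rw [hop, ofKernel_apply]
  rw [e]
  exact integral_mul_ofKernel_of_fibre (κs j g p) (ν j) (ν (j + 1)) (havg j) (hχm j g p) (hχ0 j g p) (hκ j g p hg hp)
    (hfib j g p hg hp) hm hf

end TowerForm

/-! ## §2 gaps-ne6's averaging kernels are fibre-supported almost everywhere -/

section FibreSupport

variable {X Y : Type} [MeasurableSpace X] [MeasurableSpace Y]

/-- **TWISTING PRESERVES FIBRE SUPPORT**: if `κ y` lives on the fibre of `avg` over `y`, so does `(twist κ m) y = m y • κ y`. [folklore] -/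
theorem ae_fibre_twist (κ : Kernel Y X) [IsSFiniteKernel κ] {m : Y → ℝ≥0∞} (hm : Measurable m) {avg : X → Y} {y : Y}
    (h : ∀ᵐ x ∂(κ y), avg x = y) : ∀ᵐ x ∂(twist κ m y), avg x = y := by
  rw [twist_apply κ hm]
  exact Measure.ae_smul_measure h _

variable [StandardBorelSpace X] [Nonempty X] [MeasurableEq Y] (ν : Measure X) [IsFiniteMeasure ν] (μ : Measure Y) [SigmaFinite μ]
  {avg : X → Y}

omit [SigmaFinite μ] in
/-- **THE CONDITIONAL KERNEL OF A MAP LIVES ON ITS FIBRES** (`condLaw_fibre_ae`, a.e. form): for `(ν.map avg)`-a.e. `y`, `(condLaw ν avg) y`-a.e. `x` has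
`avg x = y`. [folklore] -/
theorem ae_fibre_condLaw (havg : Measurable avg) : ∀ᵐ y ∂(ν.map avg), ∀ᵐ x ∂(condLaw ν avg y), avg x = y := by
  filter_upwards [condLaw_fibre_ae ν havg] with y hy
  have hs : MeasurableSet {x : X | avg x = y} := measurableSet_eq_fun havg measurable_const
  have h0 : condLaw ν avg y {x : X | avg x = y}ᶜ = 0 := (prob_compl_eq_zero_iff hs).2 hy
  rw [ae_iff, ← Set.compl_setOf]
  exact h0

/-- **THE AVERAGING STEP KERNEL IS FIBRE-SUPPORTED `μ`-a.e.**  Under `ν.map avg ≪ μ`, gaps-ne6's `mapStepKernel ν μ avg = twist (condLaw ν avg) (d(avg_*ν)∕dμ)`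
satisfies (FS) for `μ`-almost every `y`: where the marginal density vanishes the twisted fibre is the zero measure; where it does not, `μ`-a.e. IS
`(ν.map avg)`-a.e. (`withDensity_margDensity` + `ae_withDensity_iff`). [folklore] -/
theorem ae_fibre_mapStepKernel (havg : Measurable avg) (hac : ν.map avg ≪ μ) :
    ∀ᵐ y ∂μ, ∀ᵐ x ∂(mapStepKernel ν μ avg y), avg x = y := by
  have hm : Measurable fun y => (margDensity ν μ avg y : ℝ≥0∞) := measurable_margDensity_ennreal ν μ
  have h1 : ∀ᵐ y ∂μ.withDensity (fun y => (margDensity ν μ avg y : ℝ≥0∞)), ∀ᵐ x ∂(condLaw ν avg y), avg x = y := by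
    rw [withDensity_margDensity ν μ havg hac]
    exact ae_fibre_condLaw ν havg
  rw [ae_withDensity_iff hm] at h1
  filter_upwards [h1] with y hy
  show ∀ᵐ x ∂(twist (condLaw ν avg) (fun y => (margDensity ν μ avg y : ℝ≥0∞)) y), avg x = y
  by_cases h0 : (margDensity ν μ avg y : ℝ≥0∞) = 0
  · rw [twist_apply _ hm, h0, zero_smul, ae_zero]
    exact Filter.eventually_bot
  · exact ae_fibre_twist (condLaw ν avg) hm (hy h0)

/-- **SO IS ITS TRUNCATION** (`truncStepKernel ν μ avg C = twist (condLaw ν avg) (min (d(avg_*ν)∕dμ) C)`, gaps-ne6's (R1) of π-SK23-1). [folklore] -/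
theorem ae_fibre_truncStepKernel (havg : Measurable avg) (hac : ν.map avg ≪ μ) (C : NNReal) :
    ∀ᵐ y ∂μ, ∀ᵐ x ∂(truncStepKernel ν μ avg C y), avg x = y := by
  have hm : Measurable fun y => (margDensity ν μ avg y : ℝ≥0∞) := measurable_margDensity_ennreal ν μ
  have hmC := measurable_truncDensity ν μ (avg := avg) C
  have h1 : ∀ᵐ y ∂μ.withDensity (fun y => (margDensity ν μ avg y : ℝ≥0∞)), ∀ᵐ x ∂(condLaw ν avg y), avg x = y := by
    rw [withDensity_margDensity ν μ havg hac]
    exact ae_fibre_condLaw ν havg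
  rw [ae_withDensity_iff hm] at h1
  filter_upwards [h1] with y hy
  show ∀ᵐ x ∂(twist (condLaw ν avg) (fun y => min (margDensity ν μ avg y : ℝ≥0∞) C) y), avg x = y
  by_cases h0 : (margDensity ν μ avg y : ℝ≥0∞) = 0
  · rw [twist_apply _ hmC, h0, min_eq_left (zero_le : (0 : ℝ≥0∞) ≤ C), zero_smul, ae_zero]
    exact Filter.eventually_bot
  · exact ae_fibre_twist (condLaw ν avg) hmC (hy h0)

end FibreSupport

section Gauge

open T4FiniteEpsInhabited

variable {P : Params} {j : ℕ} {G : Type} [GaugeGroup G] [MeasurableSpace G] [HaarData G] [StandardBorelSpace G]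
  [MeasurableEq (GaugeField P (j + 1) G)]

/-- **ON GAUGE FIELDS**: under `HaarAC avg` the averaging kernel `avgKernel avg = condLaw dU avg` twisted by ANY measurable density of the coarse field is
fibre-supported `dV`-a.e. ON THE SUPPORT OF THE MARGINAL DENSITY — in particular gaps-ne6's `avgStepKernel`∕`avgTruncStepKernel` (the 𝐓-half of an (A1c)
kernel step) satisfy (FS) wherever they are non-zero. [folklore] -/
theorem ae_fibre_avgKernel_twist {avg : GaugeField P j G → GaugeField P (j + 1) G} (havg : Measurable avg) (hac : HaarAC avg)
    {m : GaugeField P (j + 1) G → ℝ≥0∞} (hm : Measurable m) :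
    ∀ᵐ V ∂fieldMeasure P (j + 1) G, (margDensity (fieldMeasure P j G) (fieldMeasure P (j + 1) G) avg V : ℝ≥0∞) ≠ 0 →
      ∀ᵐ U ∂(twist (avgKernel avg) m V), avg U = V := by
  have hd : Measurable fun V => (margDensity (fieldMeasure P j G) (fieldMeasure P (j + 1) G) avg V : ℝ≥0∞) :=
    measurable_margDensity_ennreal _ _
  have h1 : ∀ᵐ V ∂(fieldMeasure P (j + 1) G).withDensity
      (fun V => (margDensity (fieldMeasure P j G) (fieldMeasure P (j + 1) G) avg V : ℝ≥0∞)),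
      ∀ᵐ U ∂(condLaw (fieldMeasure P j G) avg V), avg U = V := by
    rw [withDensity_margDensity _ _ havg hac]
    exact ae_fibre_condLaw (fieldMeasure P j G) havg
  rw [ae_withDensity_iff hd] at h1
  filter_upwards [h1] with V hV h0
  exact ae_fibre_twist (avgKernel avg) hm (hV h0)

end Gauge

section Fibred

open Summit.QuantumFields.BalabanUV.T4Continuum.SubstrateFibredAveraging (FibredAveraging)
open Summit.QuantumFields.BalabanUV.T4Continuum.Spine.NE7b.StepKernelOfMap (fibredStepKernel fibredStepKernel_apply measurable_fibreMap)

variable {P : Params} {j : ℕ} {G : Type} [GaugeGroup G] [MeasurableSpace G] [HaarData G] [MeasurableEq (GaugeField P (j + 1) G)]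
  {avg : GaugeField P j G → GaugeField P (j + 1) G}

/-- **THE MARKOV FIBRED ROUTE IS FIBRE-SUPPORTED AT EVERY COARSE FIELD**: for a fibred averaging (the substrate cell's `FibredAveraging`: a Haar-compatible
parametrisation `Φ : Z × 𝒰_{j+1} → 𝒰_j` of the fibres with `avg ∘ Φ(·, V) = V`) gaps-ne6's `fibredStepKernel A V = (μ_Z).map (Φ(·, V))` satisfies (FS) at EVERY
`V` — no a.e., no marginal-density letter; with `fibredStepKernel_comp` (the exact measure identity) §1 makes `ofKernel (fibredStepKernel A)` a module step. [folklore] -/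
theorem ae_fibre_fibredStepKernel (A : FibredAveraging P j G avg) (havg : Measurable avg) (V : GaugeField P (j + 1) G) :
    ∀ᵐ U ∂(fibredStepKernel A V), avg U = V := by
  rw [fibredStepKernel_apply]
  refine (ae_map_iff (measurable_fibreMap A V).aemeasurable (measurableSet_eq_fun havg measurable_const)).2 ?_
  exact Filter.Eventually.of_forall fun z => A.avg_Φ z V

end Fibred

end Summit.QuantumFields.YangMills.BalabanUVNodes.N20ByValueKernelSteps
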